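import Summits.BirchSwinnertonDyer.Uniform.U2.GenusTheoryEndToEndHIdPlacewise
import HarnessLib

/-!
# Track U2 (cell `bsd-uniform`, seat u2-p1): `BSD(E, 2) ⟹ BSD(E^{(d)}, 2)` for RANK-ZERO bases on ALL
# `d ≡ 1 (mod 4)` of the a_q-odd class — the prime `2` INERT in `ℚ(√d)` allowed for bases GOOD at `2`,
# and NOTHING asked at `2` for bases of ODD conductor

HONEST FRAMING (cell `bsd-uniform`, HOME run/shared/lean/pub/bsd-uniform/, verbatim in every file of
the seat): a RELATIVE ("twist-transport") theorem, uniform in the twisting parameter `d`, CONDITIONAL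
on NAMED PUBLISHED FACTS taken BY NAME — Zhai 2016 Thm 1.1 / 1.2 AS CORRECTED (`h11` / `h12`),
Mazur–Rubin 2010 Lemma 2.10 place by place (`hMR'`, `MazurRubin2010.d2_eq_of_lemma210_rat`),
modularity (`hmod`) (+ Abbes–Ullmo Thm. A, `hAU`, on the odd-conductor variant) — and on PER-BASE
binders of the rank-`0` base `E` ONLY: a globally minimal `Γ₀(N)`-OPTIMAL model (odd Manin constant
`hν`, or `N` odd), `r_an(E) = 0`, `BSD(E, 2)`, `Ш(E)[2] = 0`, (H-2) `E(ℚ)[2] = 0`, `c(E)` odd; and the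
ARITHMETIC class condition on `(E, d)`. THERE IS NO PER-TWIST BINDER. It converts PAIRS `(E, d)` to
`BSD(E^{(d)}, 2)`, never the class X5 by itself; books nothing; moves no census number; no per-curve
certificate is counted as a uniform theorem — the base's `BSD(E, 2)`
is a per-BASE CERTIFICATE and the twists of a certified rank-`0` base are CERTIFICATE-DERIVED («transport
theorem × base certificate»), with NO per-twist certificate; only the twists of a base whose `BSD₂` is
itself LITERAL (CM / Kriz–Li families) are literal (referee V2 CORRECTION 1; wording of record V97 F97-1,
ERRATUM 2026-08-27: an earlier version of this docstring said «the twists are then LITERAL»).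

THIS FILE = `RankZeroTwistBSDTwo.lean` (p524317, `bsdp_two_twist_of_rankZero_base`: `d ≡ 1 (mod 8)`)
with Mazur–Rubin's control bound PLACE-WISE: the class condition at the prime `2` becomes «`d ≡ 1
(mod 8)` OR `E` has good reduction at `2`» (`h2`) on top of `d ≡ 1 (mod 4)` — so the `d ≡ 5 (mod 8)`
half of the class is covered for every rank-`0` base with `2 ∤ N` (HOME/RESIDUE.md R-A3′) — and for
ODD `N` the theorem `bsdp_two_twist_of_rankZero_base_oddConductor_placewise` asks NOTHING at `2`
(good reduction from `2 ∤ N`; odd Manin constant from Abbes–Ullmo). Ingredients: Zhai's unit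
(`rankZero_twist_of_zhai'`, p518943 — `d ≡ 1 (mod 4)` only), route A place-wise
(`natCard_selmerGroup_twist_eq_of_placewise` + the Selmer kernel), the `2`-adic Tamagawa balance for
unramified `d` (`padicValNat_two_tamagawaProduct_twist_eq_of_unramified`), bookkeeping as in p524317.

## Contents (theorems only; no `def`, no named fact)
* **`bsdp_two_twist_of_rankZero_base_placewise`** — `d ≡ 1 (mod 4)` under `h2`.
* **`bsdp_two_twist_of_rankZero_base_oddConductor_placewise`** — `N` odd: all `d ≡ 1 (mod 4)`.

References: Zhai 2016 [Zhai2016]; Mazur–Rubin 2010 Lemma 2.10 [MazurRubin2010]; Abbes–Ullmo 1996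
Thm. A [AbbesUllmo1996]; Silverman *ATAEC* IV.9 [SilvermanATAEC1994]; Silverman AEC VII.1, VII.5
[SilvermanAEC2009]; Miller 2011 Def. 1.1 [Miller2011LMS].
-/

noncomputable section

open scoped Classical AddSubgroup

open NumberField WeierstrassCurve Literature.NumberTheory.EllipticCurves
  Literature.NumberTheory.EllipticCurves.ModularForms
  Literature.NumberTheory.EllipticCurves.Rank1Residual
  Literature.NumberTheory.EllipticCurves.Zhai2016
  Summit.BirchSwinnertonDyer.Rank1Residual

namespace Summit.BirchSwinnertonDyer.Uniform.U2

/-- **`BSD(E, 2) ⟹ BSD(E^{(d)}, 2)` UNIFORMLY ON THE `a_q`-ODD CLASS, `d ≡ 1 (mod 4)` — rank-`0`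
optimal bases, no per-twist binder, the prime `2` inert in `ℚ(√d)` allowed when `E` is good at `2`.**
As `bsdp_two_twist_of_rankZero_base` (p524317) with `hMR : cor34ii_rat` REPLACED by the place-wise fact
`hMR' : d2_eq_of_lemma210_rat` and `hd8 : d ≡ 1 (mod 8)` REPLACED by `hd4 : d ≡ 1 (mod 4)` + `h2 :
d ≡ 1 (mod 8) ∨ E` good at `2`; every other binder byte-identical (named facts `h11`, `h12`, `hmod`;
per-base `Dt`/`hopt`/`hν`, `hr`, `hbsd`, `hSha`, `hT`, `hc`; class condition `hsqf`, `hd1`, `hgcd`,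
`hS`, `hadd`, `hmev`, `hreal`). Conclusion for every globally minimal model `WM` of `E^{(d)}`:
`r_an = 0`, rank `0`, `Ш[2^∞] = 0`, `∏ c_ℓ` odd, `BSD(E^{(d)}, 2)`.
[cite: Zhai2016, Thm. 1.1 and Thm. 1.2 (arXiv:1409.0231v2 Thm. 1.1 / 1.3)]
[cite: MazurRubin2010, Lemma 2.10 (i)–(v) with Def. 2.3, proof of Prop. 3.3 (T = ∅), and Prop. 4.2]
[cite: SilvermanATAEC1994, Cor. IV.9.2(d) and IV.9.4 Step 2] [cite: SilvermanAEC2009, VII.1 Prop. 1.3, VII.5 Prop. 5.1(a)]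
[cite: Miller2011LMS, Def. 1.1] -/
theorem bsdp_two_twist_of_rankZero_base_placewise
    -- named published facts
    (h11 : thm11_ordTwo_LAlg_twist_eq_zero') (h12 : thm12_ordTwo_LAlg_twist_eq_one')
    (hMR' : MazurRubin2010.d2_eq_of_lemma210_rat) (hmod : exists_isNewformOf)
    -- the base `E` (rank `0`, optimal, odd Manin constant) and a globally minimal model of `E^{(d)}`
    (W WM : WeierstrassCurve ℚ) [W.IsElliptic] [W.IsGloballyMinimal] [NeZero (W.conductorNorm ℤ)]
    [WM.IsElliptic] [WM.IsGloballyMinimal]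
    (Dt : ModularParametrizationData W (W.conductorNorm ℤ)) (hopt : Zhai2021.IsOptimalDatum W Dt)
    (hν : ¬ (2 : ℤ) ∣ Dt.c)
    -- PER BASE
    (hr : W.analyticRank = 0) (hbsd : BSDp W 2)
    (hSha : ∀ x : W.galH1, x ∈ W.sha → 2 • x = 0 → x = 0)
    (hT : ∀ P : W.toAffine.Point, 2 • P = 0 → P = 0) (hc : Odd W.tamagawaProduct)
    -- the class condition on `(E, d)`: `d ≡ 1 (mod 4)`; at `2`: `d ≡ 1 (mod 8)` OR good reduction
    {d : ℤ} (hsqf : Squarefree d) (hd1 : d ≠ 1) (hd4 : d % 4 = 1)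
    (h2 : d % 8 = 1 ∨ W.HasGoodReductionAtPrime 2)
    (hgcd : Int.gcd d (W.conductorNorm ℤ) = 1)
    (hS : ∀ (q : ℕ), q.Prime → (q : ℤ) ∣ d →
      ¬ (q : ℤ) ∣ minimalDiscriminantInt W ∧ Odd (W.frobeniusTrace q))
    (hadd : ∀ (p : ℕ) [Fact p.Prime], ¬ W.HasGoodReductionAtPrime p →
      ¬ W.HasMultiplicativeReductionAtPrime p → p ≠ 2 → jacobiSym d p = 1)
    (hmev : ∀ (p : ℕ) [Fact p.Prime], W.HasMultiplicativeReductionAtPrime p →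
      Even (padicValRat p W.Δ) → p ≠ 2 → jacobiSym d p = 1)
    (hreal : 0 < W.Δ → 0 < d)
    (hM : ∃ C : VariableChange ℚ, C • WM = W.quadraticTwist (d : ℚ)) :
    WM.analyticRank = 0 ∧ WM.mordellWeilRank = 0 ∧ AddCommGroup.primaryComponent WM.sha 2 = ⊥ ∧
      Odd WM.tamagawaProduct ∧ BSDp WM 2 := by
  haveI : Fact (Nat.Prime 2) := ⟨Nat.prime_two⟩
  -- ANALYTIC side: Zhai 1.1' / 1.2' (`d ≡ 1 (mod 4)` suffices)
  obtain ⟨hr', hrk, hReg, ⟨q, hq, hq0, hvq⟩, hfin⟩ := rankZero_twist_of_zhai' h11 h12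
    (WeierstrassCurve.hasEntireLFunction_rat_of_exists_isNewformOf hmod) W WM Dt hopt hν hr hbsd hSha
    hT hc hsqf hd4 hd1 hgcd hS hreal hM
  -- ALGEBRAIC side: route A place-wise — `#Sel₂(E^{(d)}) = #Sel₂(E) = 1`
  have hctrl := natCard_selmerGroup_twist_eq_of_placewise W hMR' hsqf hd1 hd4 h2 hS hadd hmev hreal WM hM
  have hW : Nat.card (W.selmerGroup 2) = 1 :=
    natCard_selmerGroup_two_eq_one_of_rank_zero W (hbsd.1.trans hr) hT hSha
  obtain ⟨-, hM2, hshaM⟩ :=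
    rank_eq_zero_and_sha_two_eq_bot_of_card_selmerGroup_two_eq_one WM (hctrl.trans hW)
  -- LOCAL side: `ord₂ ∏ c(E^{(d)}) = ord₂ ∏ c(E) = 0` (unramified `d`, good at `2` or `d ≡ 1 (mod 8)`)
  have hcv := padicValNat_two_tamagawaProduct_twist_eq_of_unramified W hd4 h2 hS hadd hmev hM
  have hc0 : padicValNat 2 W.tamagawaProduct = 0 :=
    padicValNat.eq_zero_of_not_dvd (Nat.two_dvd_ne_zero.mpr (Nat.odd_iff.mp hc))
  have hcM0 : padicValNat 2 WM.tamagawaProduct = 0 := hcv.trans hc0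
  have hcM : Odd WM.tamagawaProduct := by
    have h := hcM0
    rw [padicValNat.eq_zero_iff] at h
    rcases h with h | h | h
    · norm_num at h
    · exact absurd h WM.tamagawaProduct_pos_holds.ne'
    · exact Nat.odd_iff.mpr (Nat.two_dvd_ne_zero.mp h)
  -- odd torsion of the twist
  have h1M : Nat.card {P : WM.toAffine.Point // (2 : ℕ) • P = 0} = 1 :=
    natCard_twoTorsionSubtype_eq_one_of_torsionBy_eq_bot hM2
  have htorM : padicValNat 2 WM.torsionOrder = 0 :=
    padicValNat_torsionOrder_eq_zero_of_irreducible WM 2 (P2.irr_two_of_card_twoTorsion_eq_one WM h1M)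
  -- bookkeeping: `#Ш_an(E^{(d)}) = q T² / c`, of `2`-adic valuation `0 = ord₂ #Ш[2^∞]`
  have hTpos : (0 : ℕ) < WM.torsionOrder := WM.torsionOrder_pos_holds
  have hcpos : 0 < WM.tamagawaProduct := WM.tamagawaProduct_pos'
  have hΩ : (WM.realPeriodRat : ℂ) ≠ 0 := by exact_mod_cast WM.realPeriodRat_pos_holds.ne'
  have hTq : (WM.torsionOrder : ℚ) ≠ 0 := by exact_mod_cast hTpos.ne'
  have hcq : (WM.tamagawaProduct : ℚ) ≠ 0 := by exact_mod_cast hcpos.ne'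
  refine ⟨hr', hrk, hshaM, hcM, hrk.trans hr'.symm, finite_primaryComponent_sha_of_finite WM hfin,
    q * (WM.torsionOrder : ℚ) ^ 2 / (WM.tamagawaProduct : ℚ), ?_, ?_⟩
  · rw [shaAn_def, hq, hReg]
    push_cast
    field_simp
  · rw [hshaM, AddSubgroup.card_bot, padicValNat_one_right,
      padicValRat.div (mul_ne_zero hq0 (pow_ne_zero 2 hTq)) hcq,
      padicValRat.mul hq0 (pow_ne_zero 2 hTq), padicValRat.pow, padicValRat.of_nat,
      padicValRat.of_nat, hvq, htorM, hcM0]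
    simp

/-- **`BSD(E, 2) ⟹ BSD(E^{(d)}, 2)` UNIFORMLY ON THE `a_q`-ODD CLASS — rank-`0` optimal bases of ODD
CONDUCTOR, EVERY `d ≡ 1 (mod 4)`, NOTHING asked at the prime `2`, no per-twist binder, Manin constant by
Abbes–Ullmo.** As `bsdp_two_twist_of_rankZero_base_placewise` with `hν : 2 ∤ ν_E` DISCHARGED from the
named fact `hAU` (Abbes–Ullmo Thm. A: `p ∤ N ⟹ p ∤ ν`) and `h2` DISCHARGED from `hN2 : 2 ∤ N` (good
reduction at `2`). [cite: AbbesUllmo1996, Thm. A] [cite: Zhai2016, Thm. 1.1 and Thm. 1.2 (arXiv:1409.0231v2)]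
[cite: MazurRubin2010, Lemma 2.10 (i)–(v) with Def. 2.3, proof of Prop. 3.3 (T = ∅), and Prop. 4.2]
[cite: Miller2011LMS, Def. 1.1] -/
theorem bsdp_two_twist_of_rankZero_base_oddConductor_placewise
    -- named published facts
    (h11 : thm11_ordTwo_LAlg_twist_eq_zero') (h12 : thm12_ordTwo_LAlg_twist_eq_one')
    (hMR' : MazurRubin2010.d2_eq_of_lemma210_rat) (hmod : exists_isNewformOf)
    (hAU : abbesUllmo_not_dvd_maninConstant_of_not_dvd_level)
    -- the base `E` (rank `0`, optimal, ODD CONDUCTOR) and a globally minimal model of `E^{(d)}`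
    (W WM : WeierstrassCurve ℚ) [W.IsElliptic] [W.IsGloballyMinimal] [NeZero (W.conductorNorm ℤ)]
    [WM.IsElliptic] [WM.IsGloballyMinimal]
    (Dt : ModularParametrizationData W (W.conductorNorm ℤ)) (hopt : Zhai2021.IsOptimalDatum W Dt)
    (hN2 : ¬ 2 ∣ W.conductorNorm ℤ)
    -- PER BASE
    (hr : W.analyticRank = 0) (hbsd : BSDp W 2)
    (hSha : ∀ x : W.galH1, x ∈ W.sha → 2 • x = 0 → x = 0)
    (hT : ∀ P : W.toAffine.Point, 2 • P = 0 → P = 0) (hc : Odd W.tamagawaProduct)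
    -- the class condition on `(E, d)`: `d ≡ 1 (mod 4)` — NOTHING at the prime `2`
    {d : ℤ} (hsqf : Squarefree d) (hd1 : d ≠ 1) (hd4 : d % 4 = 1)
    (hgcd : Int.gcd d (W.conductorNorm ℤ) = 1)
    (hS : ∀ (q : ℕ), q.Prime → (q : ℤ) ∣ d →
      ¬ (q : ℤ) ∣ minimalDiscriminantInt W ∧ Odd (W.frobeniusTrace q))
    (hadd : ∀ (p : ℕ) [Fact p.Prime], ¬ W.HasGoodReductionAtPrime p →
      ¬ W.HasMultiplicativeReductionAtPrime p → p ≠ 2 → jacobiSym d p = 1)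
    (hmev : ∀ (p : ℕ) [Fact p.Prime], W.HasMultiplicativeReductionAtPrime p →
      Even (padicValRat p W.Δ) → p ≠ 2 → jacobiSym d p = 1)
    (hreal : 0 < W.Δ → 0 < d)
    (hM : ∃ C : VariableChange ℚ, C • WM = W.quadraticTwist (d : ℚ)) :
    WM.analyticRank = 0 ∧ WM.mordellWeilRank = 0 ∧ AddCommGroup.primaryComponent WM.sha 2 = ⊥ ∧
      Odd WM.tamagawaProduct ∧ BSDp WM 2 := by
  haveI : Fact (Nat.Prime 2) := ⟨Nat.prime_two⟩
  have hgood : W.HasGoodReductionAtPrime 2 := by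
    by_contra h
    exact hN2 ((W.dvd_conductorNorm_iff_not_hasGoodReductionAtPrime 2).mpr h)
  exact bsdp_two_twist_of_rankZero_base_placewise h11 h12 hMR' hmod W WM Dt hopt
    (hAU W Dt hopt 2 Nat.prime_two hN2) hr hbsd hSha hT hc hsqf hd1 hd4 (Or.inr hgood) hgcd hS hadd hmev
    hreal hM

end Summit.BirchSwinnertonDyer.Uniform.U2

end
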